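import Literature.Probability.LatticeModels.TorusLevyKhintchine
import HarnessLib

/-!
# The sharp (condensate-normalised) Goldstone-wing bound on the finite torus

A complement to `TorusLevyKhintchine.levy_wing_bound`. For a positive even function `k` on
`(ℤ/Lℤ)^d` whose logarithm has nonnegative cosine coefficients `A(q) = ∑_x log k(x) Re χ_q(x) ≥ 0`
at `q ≠ 0` (infinite divisibility of the translation-invariant kernel `k(x - y)`; Lévy coefficients
`ν_q = A(q)/L^d`), write `k̂(q) = ∑_x k(x) Re χ_q(x)` and `k̂(0) = ∑_x k(x)` (the zero mode, i.e. the
CONDENSATE weight of the kernel).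

* `levy_wing_bound_sharp` — `A(q) e^{-2A(q)/L^d} ∑_x k(x) ≤ L^d k̂(q)` for `q ≠ 0`, i.e.
  `ν_q e^{-2ν_q} ≤ k̂(q) / k̂(0)`: the Lévy coefficient of a mode is at most its structure-factor
  weight RELATIVE TO THE CONDENSATE (up to `e^{2ν_q} → 1`). The tree's `levy_wing_bound` reads
  `ν_q ≤ e^{|ν|} k̂(q) / (L^d k(0))`; since `k̂(0) ≥ L^d k(0) e^{-|ν|}` (Jensen / the Lévy floor) the
  present bound is sharper exactly when `2ν_q ≤ |ν| - log(L^d k(0)/k̂(0))` (the Jensen gap).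
* `levy_mass_on_le_sharp` — summed form on a set `T` of nonzero modes with `ν_q ≤ η` on `T`:
  `∑_{q∈T} ν_q ≤ e^{2η} (∑_{q∈T} k̂(q)) / k̂(0)`.

Method (Berg–Christensen–Ressel Ch. 3 §1: Schur products 1.12, `exp` 1.14, and Bochner on the
finite torus from `TorusLevyKhintchine` / `TorusNegTypeBochner`): with
`r = log k - log k(0) + |ν| = ∑_{p≠0} ν_p Re χ_p` split `r = a Re χ_q + r'`,
`a = A(q) / ∑_x (Re χ_q x)^2`, which removes the modes `±q`; `r'` and `Re χ_q` are of positive type,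
so `(e^{a Re χ_q} - 1 - a Re χ_q) e^{r'}` is a positive definite kernel and its `q`-th coefficient
gives `∑ e^r Re χ_q ≥ a ∑ (Re χ_q)^2 e^{r'} = (a/2)(∑ e^{r'} + ∑ e^{r'} Re χ_{2q}) ≥ (A(q)/L^d) ∑ e^{r'}`,
while `∑ e^r ≤ e^a ∑ e^{r'}` pointwise and `e^r = e^{|ν|} k/k(0)`. Probabilistic reading: for the
compound-Poisson momentum `S` with jump intensities `ν`, `P(S = q) ≥ ν_q e^{-2ν_q} P(S = 0)`
(one jump `+q`, none `-q`, the rest returns). Small character lemmas: `re_torusChar_neg_left`,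
`torusChar_add_self_left`, `re_torusChar_sq`, `sum_re_torusChar_mul_re_torusChar`,
`isPosDefKernel_re_torusChar_sub`. All statements finite-dimensional and sorry-free.

Use (route `HubbardSuperconductivity/LevyLogBootstrap`, crux `LevyTransport`): the infrared Lévy
mass is bounded by the infrared wing divided by the condensate fraction `f = k̂(0)/(L^d k(0))`
instead of multiplied by `e^{|ν|} ≥ 1/f`; the closure condition of the log-bootstrap is unchanged
in the worst case (`f ≥ e^{-|ν|}` is all that links the two), so this is a normalisation
improvement, not a new mechanism.
-/

noncomputable section

open Finset Complex Filter
open scoped ComplexConjugate BigOperators Topology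

namespace Literature.Probability.LatticeModels

open Literature.Analysis.Matrix

variable {d L : ℕ} [NeZero L]

namespace TorusLevyKhintchine

/-- `Re χ_{-k}(x) = Re χ_k(x)` (`χ_{-k} = conj χ_k`). [folklore] -/
theorem re_torusChar_neg_left (k x : TorusSite d L) :
    (torusChar (-k) x).re = (torusChar k x).re := by
  rw [torusChar_comm, re_torusChar_neg_right, torusChar_comm]

/-- `χ_{k+k}(x) = χ_k(x)^2`. [folklore] -/
theorem torusChar_add_self_left (k x : TorusSite d L) :
    torusChar (k + k) x = torusChar k x ^ 2 := by
  rw [torusChar_comm, torusChar_add_right, torusChar_comm x k, sq]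

/-- Squared cosine: `(Re χ_k(x))^2 = (1 + Re χ_{k+k}(x)) / 2` (since `|χ_k(x)| = 1`). [folklore] -/
theorem re_torusChar_sq (k x : TorusSite d L) :
    (torusChar k x).re ^ 2 = (1 + (torusChar (k + k) x).re) / 2 := by
  have h := Complex.normSq_eq_norm_sq (torusChar k x)
  rw [norm_torusChar, one_pow, Complex.normSq_apply] at h
  rw [torusChar_add_self_left, sq (torusChar k x), Complex.mul_re]
  nlinarith [h]

/-- **Product of two cosines, summed over the torus**:
`∑_x Re χ_q(x) Re χ_p(x) = (L^d 𝟙{q + p = 0} + L^d 𝟙{q - p = 0}) / 2`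
(`2 Re χ_q Re χ_p = Re χ_{q+p} + Re χ_{q-p}` and orthogonality `sum_re_torusChar`). [folklore] -/
theorem sum_re_torusChar_mul_re_torusChar (q p : TorusSite d L) :
    ∑ x, (torusChar q x).re * (torusChar p x).re =
      ((if q + p = 0 then (L : ℝ) ^ d else 0) + (if q - p = 0 then (L : ℝ) ^ d else 0)) / 2 := by
  have h : ∀ x, (torusChar q x).re * (torusChar p x).re =
      ((torusChar (q + p) x).re + (torusChar (q - p) x).re) / 2 := fun x => by
    rw [torusChar_comm (q + p), torusChar_add_right, torusChar_comm (q - p), torusChar_sub_right,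
      torusChar_comm x q, torusChar_comm x p, Complex.mul_re, Complex.mul_re, Complex.conj_re,
      Complex.conj_im]
    ring
  simp_rw [h]
  rw [← Finset.sum_div, Finset.sum_add_distrib, sum_re_torusChar, sum_re_torusChar]

/-- The cosine `x ↦ Re χ_q(x)` is a function of positive type on the torus: `Re χ_q(x - y)` is a
positive definite kernel (its cosine coefficients `(L^d 𝟙{q+p=0} + L^d 𝟙{q=p})/2` are `≥ 0`). [folklore] -/
theorem isPosDefKernel_re_torusChar_sub (q : TorusSite d L) :
    IsPosDefKernel fun x y : TorusSite d L => (torusChar q (x - y)).re := by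
  refine isPosDefKernel_sub_of_torusFourier_re_nonneg (fun x => (torusChar q x).re)
    (re_torusChar_neg_right q) fun p => ?_
  rw [sum_re_torusChar_mul_re_torusChar]
  have hN : (0 : ℝ) ≤ (L : ℝ) ^ d := by positivity
  refine div_nonneg (add_nonneg ?_ ?_) zero_le_two <;> split_ifs <;> simp [hN]

end TorusLevyKhintchine

open TorusLevyKhintchine

/-- **Sharp (condensate-normalised) Goldstone-wing bound.** Let `k > 0` be even on `(ℤ/Lℤ)^d` with
nonnegative Lévy coefficients `A(q) = ∑_x log k(x) Re χ_q(x) ≥ 0` for `q ≠ 0` (infinite divisibility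
of `k(x - y)`). Then for every `q ≠ 0`,
`A(q) · e^{-2A(q)/L^d} · ∑_x k(x) ≤ L^d · ∑_x k(x) Re χ_q(x)`, i.e. with `ν_q = A(q)/L^d`,
`k̂(q) = ∑_x k(x) Re χ_q(x)` and the ZERO MODE (condensate weight) `k̂(0) = ∑_x k(x)`:
`ν_q e^{-2ν_q} ≤ k̂(q) / k̂(0)` — the Lévy coefficient of a mode is at most its structure-factor
weight RELATIVE TO THE CONDENSATE. Compared with `levy_wing_bound` (`ν_q ≤ e^{|ν|} k̂(q)/(L^d k(0))`)
the factor `e^{|ν|}/(L^d k(0))` is replaced by `e^{2ν_q}/k̂(0)`; since `k̂(0) ≥ L^d k(0) e^{-|ν|}`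
(Jensen, the Lévy floor) this is sharper up to the factor `e^{2ν_q}` (`ν_q → 0` mode by mode).
Proof (Schur products, BCR 3.1.12–1.14): with `r = log k - log k(0) + |ν| = ∑_{p≠0} ν_p Re χ_p`
split `r = a Re χ_q + r'` where `a = A(q)/∑_x (Re χ_q x)^2` removes the modes `±q`; `r'` and
`Re χ_q` are of positive type, so `(e^{a Re χ_q} - 1 - a Re χ_q) · e^{r'}` is positive definite and
its `q`-th coefficient gives `∑ e^r Re χ_q ≥ a ∑ (Re χ_q)^2 e^{r'} = (a/2)(∑ e^{r'} + ∑ e^{r'} Re χ_{2q})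
≥ (A(q)/L^d) ∑ e^{r'}`, while `∑ e^r ≤ e^a ∑ e^{r'} ≤ e^{2A(q)/L^d} ∑ e^{r'}` pointwise; finally
`e^r = e^{|ν|} k / k(0)`. (Probabilistic reading: for the compound-Poisson momentum `S` with jump
intensities `ν`, `P(S = q) ≥ P(one jump +q, no jump -q) · P(S' = 0) ≥ ν_q e^{-2ν_q} P(S = 0)`.)
[cite: BergChristensenRessel1984, Ch. 3 Thm. 1.12 and Cor. 1.14 (PDF p. 71)] -/
theorem levy_wing_bound_sharp (k : TorusSite d L → ℝ) (hpos : ∀ x, 0 < k x)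
    (heven : ∀ x, k (-x) = k x)
    (hA : ∀ q : TorusSite d L, q ≠ 0 → 0 ≤ ∑ x, Real.log (k x) * (torusChar q x).re)
    (q : TorusSite d L) (hq : q ≠ 0) :
    (∑ x, Real.log (k x) * (torusChar q x).re) *
        Real.exp (-(2 * ∑ x, Real.log (k x) * (torusChar q x).re) / (L : ℝ) ^ d) * ∑ x, k x ≤
      (L : ℝ) ^ d * ∑ x, k x * (torusChar q x).re := by
  have hL0 : (0 : ℝ) < (L : ℝ) ^ d := pow_pos (Nat.cast_pos.2 (Nat.pos_of_ne_zero (NeZero.ne L))) d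
  have hk0 : 0 < k 0 := hpos 0
  set N : ℝ := (L : ℝ) ^ d with hN
  set Aq : ℝ := ∑ x, Real.log (k x) * (torusChar q x).re with hAq
  have hAq0 : 0 ≤ Aq := hA q hq
  set m : ℝ := (∑ z, (Real.log (k 0) - Real.log (k z))) / N with hm
  set r : TorusSite d L → ℝ := fun x => Real.log (k x) - Real.log (k 0) + m with hr
  set c : TorusSite d L → ℝ := fun x => (torusChar q x).re with hc
  have hreven : ∀ x, r (-x) = r x := fun x => by simp only [hr, heven]
  have hceven : ∀ x, c (-x) = c x := fun x => by simp only [hc, re_torusChar_neg_right]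
  have hc_le : ∀ x, c x ≤ 1 := fun x => re_torusChar_le_one q x
  -- the cosine coefficients of `r`: `A(p)` at `p ≠ 0`, `0` at `p = 0`
  have hexp : ∀ p : TorusSite d L, ∑ x, r x * (torusChar p x).re =
      ∑ x, Real.log (k x) * (torusChar p x).re +
        (m - Real.log (k 0)) * ∑ x, (torusChar p x).re := fun p => by
    rw [Finset.mul_sum, ← Finset.sum_add_distrib]
    exact Finset.sum_congr rfl fun x _ => by simp only [hr]; ring
  have hNm : N * m = ∑ z, (Real.log (k 0) - Real.log (k z)) := by
    rw [hm, mul_div_cancel₀ _ hL0.ne']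
  have hcoefr : ∀ p : TorusSite d L, p ≠ 0 →
      ∑ x, r x * (torusChar p x).re = ∑ x, Real.log (k x) * (torusChar p x).re := fun p hp => by
    rw [hexp p, sum_re_torusChar, if_neg hp, mul_zero, add_zero]
  have hcoefr0 : ∑ x, r x * (torusChar 0 x).re = 0 := by
    rw [hexp 0, sum_re_torusChar, if_pos rfl]
    simp only [torusChar_zero_left, Complex.one_re, mul_one]
    rw [Finset.sum_sub_distrib, Finset.sum_const, Finset.card_univ, nsmul_eq_mul] at hNm
    have hcard : (Fintype.card (TorusSite d L) : ℝ) = N := by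
      rw [hN, ← sum_one_eq_pow, Finset.sum_const, Finset.card_univ, nsmul_eq_mul, mul_one]
    rw [hcard] at hNm
    linarith [hNm]
  have hcoefr_nonneg : ∀ p : TorusSite d L, 0 ≤ ∑ x, r x * (torusChar p x).re := fun p => by
    by_cases hp : p = 0
    · rw [hp, hcoefr0]
    · rw [hcoefr p hp]; exact hA p hp
  -- the squared-cosine mass `s` of the mode `q` and the amplitude `a`
  set s : ℝ := ∑ x, c x ^ 2 with hs
  have hs_eq : s = ((if q + q = 0 then N else 0) + N) / 2 := by
    have h1 : s = ∑ x, (torusChar q x).re * (torusChar q x).re :=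
      Finset.sum_congr rfl fun x _ => by rw [hc, sq]
    rw [h1, sum_re_torusChar_mul_re_torusChar, sub_self, if_pos rfl]
  have hs_ge : N / 2 ≤ s := by rw [hs_eq]; split_ifs <;> linarith
  have hs_le : s ≤ N := by rw [hs_eq]; split_ifs <;> linarith
  have hs0 : 0 < s := lt_of_lt_of_le (by linarith) hs_ge
  set a : ℝ := Aq / s with ha
  have ha0 : 0 ≤ a := div_nonneg hAq0 hs0.le
  have has : a * s = Aq := by rw [ha, div_mul_cancel₀ _ hs0.ne']
  have ha_le : a ≤ 2 * Aq / N := by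
    rw [ha, div_le_div_iff₀ hs0 hL0]
    nlinarith [hAq0, hs_ge]
  -- the split `r = a c + r'` and the coefficients of `r'`
  set r' : TorusSite d L → ℝ := fun x => r x - a * c x with hr'
  have hr'even : ∀ x, r' (-x) = r' x := fun x => by simp only [hr', hreven, hceven]
  have hcoefc : ∀ p : TorusSite d L, ∑ x, c x * (torusChar p x).re =
      ((if q + p = 0 then N else 0) + (if q - p = 0 then N else 0)) / 2 := fun p =>
    sum_re_torusChar_mul_re_torusChar q p
  have hcoefr' : ∀ p : TorusSite d L, ∑ x, r' x * (torusChar p x).re =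
      ∑ x, r x * (torusChar p x).re - a * ∑ x, c x * (torusChar p x).re := fun p => by
    rw [Finset.mul_sum, ← Finset.sum_sub_distrib]
    exact Finset.sum_congr rfl fun x _ => by simp only [hr']; ring
  have hcoefr'_nonneg : ∀ p : TorusSite d L, 0 ≤ ∑ x, r' x * (torusChar p x).re := by
    intro p
    rw [hcoefr' p, hcoefc p]
    by_cases hpq : p = q
    · subst hpq
      rw [hcoefr p hq, sub_self, if_pos rfl, ← hAq, ← has, hs_eq]
      exact le_of_eq (by ring)
    · by_cases hpq' : p = -q
      · subst hpq'
        have hnq : -q ≠ 0 := fun h => hq (neg_eq_zero.1 h)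
        rw [hcoefr _ hnq, add_neg_cancel, if_pos rfl, sub_neg_eq_add]
        have hAneg : ∑ x, Real.log (k x) * (torusChar (-q) x).re = Aq :=
          Finset.sum_congr rfl fun x _ => by rw [re_torusChar_neg_left]
        rw [hAneg, ← has, hs_eq]
        exact le_of_eq (by ring)
      · have h1 : q + p ≠ 0 := fun h => hpq' (eq_neg_of_add_eq_zero_right h)
        have h2 : q - p ≠ 0 := fun h => hpq (sub_eq_zero.1 h).symm
        rw [if_neg h1, if_neg h2, add_zero, zero_div, mul_zero, sub_zero]
        exact hcoefr_nonneg p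
  -- positive type: `r'`, `a c`, `exp (a c) - 1 - a c`, `exp r'`, and the product
  have hPDr' : IsPosDefKernel fun x y : TorusSite d L => r' (x - y) :=
    isPosDefKernel_sub_of_torusFourier_re_nonneg r' hr'even hcoefr'_nonneg
  have hPDc : IsPosDefKernel fun x y : TorusSite d L => a * c (x - y) :=
    (isPosDefKernel_re_torusChar_sub q).const_mul ha0
  have hPDE : IsPosDefKernel fun x y : TorusSite d L =>
      Real.exp (a * c (x - y)) - 1 - a * c (x - y) := hPDc.exp_sub_one_sub
  have hPDG : IsPosDefKernel fun x y : TorusSite d L => Real.exp (r' (x - y)) := hPDr'.exp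
  set F : TorusSite d L → ℝ := fun z => (Real.exp (a * c z) - 1 - a * c z) * Real.exp (r' z)
    with hF
  have hPDF : IsPosDefKernel fun x y : TorusSite d L => F (x - y) := hPDE.mul hPDG
  have hND : IsNegDefKernel fun x y : TorusSite d L => -F (x - y) := hPDF.isNegDefKernel_neg
  have hFq := torusFourier_re_nonneg_of_isNegDefKernel_neg_sub F hND q hq
  have hNDG : IsNegDefKernel fun x y : TorusSite d L => -(fun z => Real.exp (r' z)) (x - y) :=
    hPDG.isNegDefKernel_neg
  have hGq := torusFourier_re_nonneg_of_isNegDefKernel_neg_sub (fun z => Real.exp (r' z)) hNDG q hq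
  -- pointwise identities
  have hrsplit : ∀ x, r x = a * c x + r' x := fun x => by simp only [hr']; ring
  have hexpr : ∀ x, Real.exp (r x) = Real.exp (a * c x) * Real.exp (r' x) := fun x => by
    rw [hrsplit x, Real.exp_add]
  -- expand the `q`-th coefficient of `F`
  have hFsplit : ∑ x, F x * (torusChar q x).re =
      ∑ x, Real.exp (r x) * (torusChar q x).re - ∑ x, Real.exp (r' x) * (torusChar q x).re -
        a * ∑ x, c x ^ 2 * Real.exp (r' x) := by
    rw [Finset.mul_sum, ← Finset.sum_sub_distrib, ← Finset.sum_sub_distrib]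
    refine Finset.sum_congr rfl fun x _ => ?_
    simp only [hF, hexpr x, hc]
    ring
  have hmain1 : a * ∑ x, c x ^ 2 * Real.exp (r' x) ≤ ∑ x, Real.exp (r x) * (torusChar q x).re := by
    rw [hFsplit] at hFq
    linarith
  -- the squared cosine averages to one half (plus a nonnegative `2q`-mode)
  have hsq : ∑ x, c x ^ 2 * Real.exp (r' x) =
      (∑ x, Real.exp (r' x)) / 2 + (∑ x, Real.exp (r' x) * (torusChar (q + q) x).re) / 2 := by
    rw [← add_div, ← Finset.sum_add_distrib, Finset.sum_div]
    refine Finset.sum_congr rfl fun x _ => ?_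
    simp only [hc]
    rw [re_torusChar_sq]
    ring
  have hmain2 : Aq / N * ∑ x, Real.exp (r' x) ≤ a * ∑ x, c x ^ 2 * Real.exp (r' x) := by
    have hE0 : 0 ≤ ∑ x, Real.exp (r' x) := Finset.sum_nonneg fun x _ => (Real.exp_pos _).le
    by_cases h2q : q + q = 0
    · -- `2q = 0`: `Re χ_{2q} = 1`, `s = N`, `a = Aq / N`
      have hsN : s = N := by rw [hs_eq, if_pos h2q]; ring
      have haN : a = Aq / N := by rw [ha, hsN]
      rw [hsq, h2q, haN]
      simp only [torusChar_zero_left, Complex.one_re, mul_one]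
      exact le_of_eq (by ring)
    · -- `2q ≠ 0`: the `2q`-mode of `exp r'` is `≥ 0`, `s = N/2`, `a = 2 Aq / N`
      have hsN : s = N / 2 := by rw [hs_eq, if_neg h2q]; ring
      have haN : a = 2 * Aq / N := by rw [ha, hsN]; field_simp
      have hG2 := torusFourier_re_nonneg_of_isNegDefKernel_neg_sub (fun z => Real.exp (r' z))
        hNDG (q + q) h2q
      rw [hsq, haN]
      have : 2 * Aq / N * ((∑ x, Real.exp (r' x)) / 2) = Aq / N * ∑ x, Real.exp (r' x) := by ring
      nlinarith [mul_nonneg (div_nonneg hAq0 hL0.le) hG2, this]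
  -- pointwise: `exp r ≤ e^a exp r'`, hence `∑ exp r' ≥ e^{-2Aq/N} ∑ exp r`
  have hmain3 : Real.exp (-(2 * Aq) / N) * ∑ x, Real.exp (r x) ≤ ∑ x, Real.exp (r' x) := by
    rw [Finset.mul_sum]
    refine Finset.sum_le_sum fun x _ => ?_
    rw [hexpr x, ← mul_assoc, ← Real.exp_add]
    have h1 : -(2 * Aq) / N + a * c x ≤ 0 := by
      have : a * c x ≤ a := by nlinarith [hc_le x, ha0]
      have : -(2 * Aq) / N = -(2 * Aq / N) := by ring
      linarith
    calc Real.exp (-(2 * Aq) / N + a * c x) * Real.exp (r' x)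
        ≤ 1 * Real.exp (r' x) :=
          mul_le_mul_of_nonneg_right (Real.exp_le_one_iff.2 h1) (Real.exp_pos _).le
      _ = Real.exp (r' x) := one_mul _
  -- combine: `Aq/N e^{-2Aq/N} ∑ e^r ≤ ∑ e^r Re χ_q`
  have hcomb : Aq / N * (Real.exp (-(2 * Aq) / N) * ∑ x, Real.exp (r x)) ≤
      ∑ x, Real.exp (r x) * (torusChar q x).re :=
    calc Aq / N * (Real.exp (-(2 * Aq) / N) * ∑ x, Real.exp (r x))
        ≤ Aq / N * ∑ x, Real.exp (r' x) :=
          mul_le_mul_of_nonneg_left hmain3 (div_nonneg hAq0 hL0.le)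
      _ ≤ _ := hmain2.trans hmain1
  -- substitute `exp r = (e^m / k 0) k`
  have hexpk : ∀ x, Real.exp (r x) = Real.exp m / k 0 * k x := fun x => by
    simp only [hr]
    rw [Real.exp_add, Real.exp_sub, Real.exp_log (hpos x), Real.exp_log hk0]
    field_simp
  have hS1 : ∑ x, Real.exp (r x) = Real.exp m / k 0 * ∑ x, k x := by
    rw [Finset.mul_sum]; exact Finset.sum_congr rfl fun x _ => hexpk x
  have hS2 : ∑ x, Real.exp (r x) * (torusChar q x).re =
      Real.exp m / k 0 * ∑ x, k x * (torusChar q x).re := by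
    rw [Finset.mul_sum]; exact Finset.sum_congr rfl fun x _ => by rw [hexpk x]; ring
  have hκ : 0 < Real.exp m / k 0 := div_pos (Real.exp_pos m) hk0
  rw [hS1, hS2] at hcomb
  -- cancel the common positive factor and multiply by `N`
  have hcomb' : Aq / N * (Real.exp (-(2 * Aq) / N) * ∑ x, k x) ≤ ∑ x, k x * (torusChar q x).re := by
    have h := mul_le_mul_of_nonneg_left hcomb (inv_pos.2 hκ).le
    have e1 : (Real.exp m / k 0)⁻¹ * (Aq / N * (Real.exp (-(2 * Aq) / N) *
        (Real.exp m / k 0 * ∑ x, k x))) = Aq / N * (Real.exp (-(2 * Aq) / N) * ∑ x, k x) := by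
      field_simp
    have e2 : (Real.exp m / k 0)⁻¹ * (Real.exp m / k 0 * ∑ x, k x * (torusChar q x).re) =
        ∑ x, k x * (torusChar q x).re := by
      rw [← mul_assoc, inv_mul_cancel₀ hκ.ne', one_mul]
    rwa [e1, e2] at h
  have h := mul_le_mul_of_nonneg_left hcomb' hL0.le
  calc Aq * Real.exp (-(2 * Aq) / N) * ∑ x, k x
      = N * (Aq / N * (Real.exp (-(2 * Aq) / N) * ∑ x, k x)) := by field_simp
    _ ≤ N * ∑ x, k x * (torusChar q x).re := h

/-- **Infrared Lévy mass relative to the condensate.** Under the hypotheses of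
`levy_wing_bound_sharp`, for any set `T` of nonzero modes on which the Lévy coefficients are
uniformly small, `A(q) ≤ L^d η` for `q ∈ T` (i.e. `ν_q ≤ η`):
`e^{-2η} (∑_{q∈T} A(q)) ∑_x k(x) ≤ L^d ∑_{q∈T} ∑_x k(x) Re χ_q(x)`, i.e.
`∑_{q∈T} ν_q ≤ e^{2η} (∑_{q∈T} k̂(q)) / k̂(0)`: the Lévy mass carried by `T` is at most `e^{2η}`
times the structure-factor weight of `T` divided by the CONDENSATE weight `k̂(0) = ∑_x k(x)`
(for `levyMass_le_logBootstrap` the denominator is `L^d k(0) ≥ k̂(0)` and the prefactor `e^{|ν|}`).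
Termwise from `levy_wing_bound_sharp` and monotonicity of `exp`.
[cite: BergChristensenRessel1984, Ch. 3 Thm. 1.12 and Cor. 1.14 (PDF p. 71)] -/
theorem levy_mass_on_le_sharp (k : TorusSite d L → ℝ) (hpos : ∀ x, 0 < k x)
    (heven : ∀ x, k (-x) = k x)
    (hA : ∀ q : TorusSite d L, q ≠ 0 → 0 ≤ ∑ x, Real.log (k x) * (torusChar q x).re)
    (T : Finset (TorusSite d L)) (hT : ∀ q ∈ T, q ≠ 0) (η : ℝ)
    (hη : ∀ q ∈ T, ∑ x, Real.log (k x) * (torusChar q x).re ≤ (L : ℝ) ^ d * η) :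
    Real.exp (-(2 * η)) * (∑ q ∈ T, ∑ x, Real.log (k x) * (torusChar q x).re) * ∑ x, k x ≤
      (L : ℝ) ^ d * ∑ q ∈ T, ∑ x, k x * (torusChar q x).re := by
  have hL0 : (0 : ℝ) < (L : ℝ) ^ d := pow_pos (Nat.cast_pos.2 (Nat.pos_of_ne_zero (NeZero.ne L))) d
  have hK : 0 ≤ ∑ x, k x := Finset.sum_nonneg fun x _ => (hpos x).le
  have hL : Real.exp (-(2 * η)) * (∑ q ∈ T, ∑ x, Real.log (k x) * (torusChar q x).re) * ∑ x, k x =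
      ∑ q ∈ T, Real.exp (-(2 * η)) * (∑ x, Real.log (k x) * (torusChar q x).re) * ∑ x, k x := by
    rw [Finset.mul_sum T, Finset.sum_mul T]
  have hR : (L : ℝ) ^ d * ∑ q ∈ T, ∑ x, k x * (torusChar q x).re =
      ∑ q ∈ T, (L : ℝ) ^ d * ∑ x, k x * (torusChar q x).re := Finset.mul_sum _ _ _
  rw [hL, hR]
  refine Finset.sum_le_sum fun q hqT => ?_
  have hq := hT q hqT
  have hw := levy_wing_bound_sharp k hpos heven hA q hq
  set Aq : ℝ := ∑ x, Real.log (k x) * (torusChar q x).re with hAq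
  have hAq0 : 0 ≤ Aq := hA q hq
  have hmono : Real.exp (-(2 * η)) ≤ Real.exp (-(2 * Aq) / (L : ℝ) ^ d) := by
    refine Real.exp_le_exp.2 ?_
    rw [neg_div, neg_le_neg_iff, div_le_iff₀ hL0]
    nlinarith [hη q hqT]
  calc Real.exp (-(2 * η)) * Aq * ∑ x, k x
      = Real.exp (-(2 * η)) * (Aq * ∑ x, k x) := by ring
    _ ≤ Real.exp (-(2 * Aq) / (L : ℝ) ^ d) * (Aq * ∑ x, k x) :=
        mul_le_mul_of_nonneg_right hmono (mul_nonneg hAq0 hK)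
    _ = Aq * Real.exp (-(2 * Aq) / (L : ℝ) ^ d) * ∑ x, k x := by ring
    _ ≤ (L : ℝ) ^ d * ∑ x, k x * (torusChar q x).re := hw

end Literature.Probability.LatticeModels

end
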